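import Literature.MathematicalPhysics.QuantumChemistry.GarrodPercusEigenvalueBound
import Literature.MathematicalPhysics.QuantumChemistry.T2Condition
import HarnessLib

/-!
# An operator bound for the `T2` block: `λ_max(T2) ≤ N(r + 2)` on the `PQGT1T2`-feasible set

Topic `Literature/MathematicalPhysics/QuantumChemistry`; companion of `GarrodPercusEigenvalueBound.lean`
(the engine `posSemidef_sum_smul_one_sub_of_rowBlocks` and the Garrod–Percus bound `N · 1 − Γ ⪰ 0`),
`ThreeIndexRelaxationBound.lean` (the `T2` functional `t2Map γ Γ`, Nakata et al. 2008 §II.A) and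
`T2Condition.lean` (the `PQGT1T2` rung `IsDQGT1T2Feasible`). HONEST FRAMING (cell chem-oracle,
LADDER-CHEM I-TYPE slot 08): statements about a finite model Hamiltonian's reduced density matrices and
their semidefinite relaxations; this file certifies no number.

THE PRINTED STARTING POINT. Chaykin, Jansson, Keil, Lange, Ohlhus, Rump (2016) §4.1 bound the `T2`
block of the primal variable by its TRACE: "`tr(T2) = −rN(N−1) + r²N − rN = rN(r−N)` … Hence the upper
eigenvalue bounds … `λmax(T2) ≤ Nr(r−N)`, `λmax(T2′) ≤ N(r(r−N)+1)` (4.6)" (the constants `x̄_j` of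
their Theorem 2 (5.19), "upper bounds for the maximal eigenvalues of the primal feasible solution");
Chaykin's thesis (2009) Tab. 3.4 p. 57 records that these trace bounds overestimate `λmax(T1)`,
`λmax(T2)` by two to three orders of magnitude on the test molecules.
[cite: ChaykinEtAl2016RigorousESC, §4.1 eqs. (4.5)-(4.6), p. 15; §5 Thm 2 (5.19), p. 22]

WHAT IS PROVED HERE (0 sorry, no definition, no named fact) — a SHARPER constant, proved from the
printed `T2` formula (Nakata et al. 2008 §II.A, `t2Map_apply`) and NOT itself in print:

* `t2Map_thirdBlock_eq` — the block of `T2` on the triples `(i, j, k)` with FIXED annihilator index `k`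
  is, as a matrix on ordered pairs, `Γ − K₁ + K₂ + K₃ − K₄ + γ_kk (E − P)` with the Kronecker-type
  matrices `K₁ = δ_li Γ_k(j,m)`, `K₂ = δ_lj Γ_k(i,m)`, `K₃ = δ_mi Γ_k(j,l)`, `K₄ = δ_mj Γ_k(i,l)`
  (`Γ_k = Γ_{(k,·),(k,·)}`), `E = 1`, `P =` pair swap — read off `t2Map_apply` at `n = k`;
* `re_quadForm_t2Map_thirdBlock_le` — hence for every `x`,
  `Re x* T2_{(··k),(··k)} x = Re x*Γx + γ_kk(‖x‖² − Re⟨x, xᵀ⟩) − Σ_i (x_i − xᵀ_i)* Γ_k (x_i − xᵀ_i)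
   ≤ (N + 2γ_kk) ‖x‖²` on the DQG-feasible set (Garrod–Percus `Γ ⪯ N`, `Γ_k ⪰ 0`, `γ_kk ≥ 0`), i.e.
  `IsDQGT1T2Feasible.posSemidef_smul_one_sub_t2Map_thirdBlock`: `(N + 2γ_kk) · 1 − T2_{(··k),(··k)} ⪰ 0`;
* **`IsDQGT1T2Feasible.posSemidef_smul_one_sub_t2Map`** — by the engine over the annihilator index,
  `N(r + 2) · 1 − T2 ⪰ 0` on the `PQGT1T2`-feasible set (`Σ_k (N + 2γ_kk) = rN + 2N`), and the same on
  the `PQGT1T2′` set (`IsDQGT1T2PrimeFeasible.posSemidef_smul_one_sub_t2Map`). Compared with the printed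
  `rN(r−N)` the constant is smaller by the factor `r(r−N)/(r+2)` (`|ι| = 56, N = 14`: `32928 → 812`).

The bound enters the a-posteriori certificate exactly like the other `x̄_j` (hypotheses `hub` of
`JanssonChaykinKeil.theorem_3_2`, `hXub` of `Jansson2007.corollary_6_1a_feasible`); it is a statement
about the RELAXED feasible set, valid for every pair the SDP can produce.
-/

noncomputable section

namespace Literature.MathematicalPhysics.QuantumChemistry

open Matrix Finset Literature.MathematicalPhysics.QuantumLattice
open scoped ComplexOrder

section ThirdBlock

variable {ι : Type*} [LinearOrder ι] [Fintype ι]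

/-! ### Kronecker-type pieces of the third-index block and their quadratic forms -/

/-- `(K₁ y)(i,j) = Σ_m A_{jm} y_{im}` for `K₁ = δ_li A_{jm}` (plumbing). [folklore] -/
private theorem mulVec_kron_fst_fst (Γ : Matrix (ι × ι) (ι × ι) ℂ) (k : ι) (y : ι × ι → ℂ)
    (p : ι × ι) :
    ((Matrix.of fun p q : ι × ι => (if q.1 = p.1 then (1 : ℂ) else 0) * Γ (k, p.2) (k, q.2)) *ᵥ y) p =
      (Γ.submatrix (Prod.mk k) (Prod.mk k) *ᵥ fun m => y (p.1, m)) p.2 := by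
  simp only [mulVec, dotProduct, of_apply, submatrix_apply, Fintype.sum_prod_type, ite_mul, one_mul,
    zero_mul, Finset.sum_ite_irrel, Finset.sum_const_zero, Finset.sum_ite_eq', Finset.mem_univ, if_true]

/-- `(K₂ y)(i,j) = Σ_m A_{im} y_{jm}` for `K₂ = δ_lj A_{im}` (plumbing). [folklore] -/
private theorem mulVec_kron_fst_snd (Γ : Matrix (ι × ι) (ι × ι) ℂ) (k : ι) (y : ι × ι → ℂ)
    (p : ι × ι) :
    ((Matrix.of fun p q : ι × ι => (if q.1 = p.2 then (1 : ℂ) else 0) * Γ (k, p.1) (k, q.2)) *ᵥ y) p =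
      (Γ.submatrix (Prod.mk k) (Prod.mk k) *ᵥ fun m => y (p.2, m)) p.1 := by
  simp only [mulVec, dotProduct, of_apply, submatrix_apply, Fintype.sum_prod_type, ite_mul, one_mul,
    zero_mul, Finset.sum_ite_irrel, Finset.sum_const_zero, Finset.sum_ite_eq', Finset.mem_univ, if_true]

/-- `(K₃ y)(i,j) = Σ_l A_{jl} y_{li}` for `K₃ = δ_mi A_{jl}` (plumbing). [folklore] -/
private theorem mulVec_kron_snd_fst (Γ : Matrix (ι × ι) (ι × ι) ℂ) (k : ι) (y : ι × ι → ℂ)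
    (p : ι × ι) :
    ((Matrix.of fun p q : ι × ι => (if q.2 = p.1 then (1 : ℂ) else 0) * Γ (k, p.2) (k, q.1)) *ᵥ y) p =
      (Γ.submatrix (Prod.mk k) (Prod.mk k) *ᵥ fun l => y (l, p.1)) p.2 := by
  simp only [mulVec, dotProduct, of_apply, submatrix_apply, Fintype.sum_prod_type, ite_mul, one_mul,
    zero_mul, Finset.sum_ite_eq', Finset.mem_univ, if_true]

/-- `(K₄ y)(i,j) = Σ_l A_{il} y_{lj}` for `K₄ = δ_mj A_{il}` (plumbing). [folklore] -/
private theorem mulVec_kron_snd_snd (Γ : Matrix (ι × ι) (ι × ι) ℂ) (k : ι) (y : ι × ι → ℂ)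
    (p : ι × ι) :
    ((Matrix.of fun p q : ι × ι => (if q.2 = p.2 then (1 : ℂ) else 0) * Γ (k, p.1) (k, q.1)) *ᵥ y) p =
      (Γ.submatrix (Prod.mk k) (Prod.mk k) *ᵥ fun l => y (l, p.2)) p.1 := by
  simp only [mulVec, dotProduct, of_apply, submatrix_apply, Fintype.sum_prod_type, ite_mul, one_mul,
    zero_mul, Finset.sum_ite_eq', Finset.mem_univ, if_true]

/-- `(E y) = y` for `E = δ_li δ_mj` (plumbing). [folklore] -/
private theorem mulVec_delta_id (y : ι × ι → ℂ) (p : ι × ι) :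
    ((Matrix.of fun p q : ι × ι =>
      (if q.1 = p.1 then (1 : ℂ) else 0) * (if q.2 = p.2 then (1 : ℂ) else 0)) *ᵥ y) p = y p := by
  simp only [mulVec, dotProduct, of_apply, Fintype.sum_prod_type, ite_mul, one_mul, zero_mul,
    Finset.sum_ite_irrel, Finset.sum_const_zero, Finset.sum_ite_eq', Finset.mem_univ, if_true]

/-- `(P y)(i,j) = y(j,i)` for `P = δ_lj δ_mi` (plumbing). [folklore] -/
private theorem mulVec_delta_swap (y : ι × ι → ℂ) (p : ι × ι) :
    ((Matrix.of fun p q : ι × ι =>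
      (if q.1 = p.2 then (1 : ℂ) else 0) * (if q.2 = p.1 then (1 : ℂ) else 0)) *ᵥ y) p = y (p.2, p.1) := by
  simp only [mulVec, dotProduct, of_apply, Fintype.sum_prod_type, ite_mul, one_mul, zero_mul,
    Finset.sum_ite_irrel, Finset.sum_const_zero, Finset.sum_ite_eq', Finset.mem_univ, if_true]

omit [Fintype ι] in
/-- **The third-index block of `T2` read off the printed formula** (Nakata et al. 2008 §II.A,
`T2^{ijk}_{lmn}` at `n = k`): `T2_{(ijk),(lmk)} = Γ^{ij}_{lm} − δ_li Γ^{kj}_{km} + δ_lj Γ^{ki}_{km}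
+ δ_mi Γ^{kj}_{kl} − δ_mj Γ^{ki}_{kl} + (δ_li δ_mj − δ_lj δ_mi) γ^k_k`. [cite: NakataEtAl2008, §II.A] -/
theorem t2Map_thirdBlock_eq (γ : Matrix ι ι ℂ) (Γ : Matrix (ι × ι) (ι × ι) ℂ) (k : ι) :
    (t2Map γ Γ).submatrix (fun p : ι × ι => (p.1, p.2, k)) (fun p : ι × ι => (p.1, p.2, k)) =
      Γ - (Matrix.of fun p q : ι × ι => (if q.1 = p.1 then (1 : ℂ) else 0) * Γ (k, p.2) (k, q.2))
        + (Matrix.of fun p q : ι × ι => (if q.1 = p.2 then (1 : ℂ) else 0) * Γ (k, p.1) (k, q.2))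
        + (Matrix.of fun p q : ι × ι => (if q.2 = p.1 then (1 : ℂ) else 0) * Γ (k, p.2) (k, q.1))
        - (Matrix.of fun p q : ι × ι => (if q.2 = p.2 then (1 : ℂ) else 0) * Γ (k, p.1) (k, q.1))
        + γ k k • ((Matrix.of fun p q : ι × ι =>
              (if q.1 = p.1 then (1 : ℂ) else 0) * (if q.2 = p.2 then (1 : ℂ) else 0))
            - (Matrix.of fun p q : ι × ι =>
              (if q.1 = p.2 then (1 : ℂ) else 0) * (if q.2 = p.1 then (1 : ℂ) else 0))) := by
  ext p q
  simp only [submatrix_apply, t2Map_apply, if_true, one_mul, Matrix.add_apply, Matrix.sub_apply,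
    Matrix.smul_apply, of_apply, smul_eq_mul]
  ring

variable {N : ℕ} {γ : Matrix ι ι ℂ} {Γ : Matrix (ι × ι) (ι × ι) ℂ}

/-- `u* · u = Σ_p ‖u_p‖²` (as a complex number; plumbing). [folklore] -/
private theorem star_dotProduct_self_eq_ofReal_sum' {m : Type*} [Fintype m] (u : m → ℂ) :
    star u ⬝ᵥ u = ((∑ p, ‖u p‖ ^ 2 : ℝ) : ℂ) := by
  rw [dotProduct, Complex.ofReal_sum]
  refine Finset.sum_congr rfl fun p _ => ?_
  rw [Pi.star_apply, Complex.star_def, Complex.conj_mul', Complex.ofReal_pow]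

/-- A Löwner bound `w · 1 − A ⪰ 0` on one vector: `Re (c* A c) ≤ w · Σ_j ‖c_j‖²` (plumbing). [folklore] -/
private theorem re_quadForm_le_of_smul_one_sub {m : Type*} [Fintype m] [DecidableEq m]
    {A : Matrix m m ℂ} {w : ℝ} (h : ((w : ℂ) • (1 : Matrix m m ℂ) - A).PosSemidef) (c : m → ℂ) :
    (star c ⬝ᵥ (A *ᵥ c)).re ≤ w * ∑ j, ‖c j‖ ^ 2 := by
  have h0 := Complex.nonneg_iff.mp (h.dotProduct_mulVec_nonneg c)
  rw [sub_mulVec, smul_mulVec, one_mulVec, dotProduct_sub, dotProduct_smul, smul_eq_mul,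
    star_dotProduct_self_eq_ofReal_sum', ← Complex.ofReal_mul, Complex.sub_re, Complex.ofReal_re] at h0
  linarith [h0.1]

omit [LinearOrder ι] in
/-- `Re ⟨x, xᵀ⟩ ≥ −‖x‖²` for the pair transpose `xᵀ(i,j) = x(j,i)` (from `‖x + xᵀ‖² ≥ 0`; plumbing). [folklore] -/
private theorem neg_sum_norm_sq_le_re_dotProduct_swap (x : ι × ι → ℂ) :
    -(∑ p : ι × ι, ‖x p‖ ^ 2) ≤ (star x ⬝ᵥ fun p : ι × ι => x (p.2, p.1)).re := by
  have hswap : ∑ p : ι × ι, ‖x (p.2, p.1)‖ ^ 2 = ∑ p : ι × ι, ‖x p‖ ^ 2 :=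
    Fintype.sum_equiv (Equiv.prodComm ι ι) _ _ fun p => rfl
  rw [dotProduct, Complex.re_sum]
  have hterm : ∀ p : ι × ι,
      -((‖x p‖ ^ 2 + ‖x (p.2, p.1)‖ ^ 2)) ≤ 2 * (star (x p) * x (p.2, p.1)).re := by
    intro p
    have h0 := Complex.normSq_nonneg (x (p.2, p.1) + x p)
    rw [Complex.normSq_add, ← Complex.sq_norm, ← Complex.sq_norm] at h0
    have hre : (x (p.2, p.1) * (starRingEnd ℂ) (x p)).re = (star (x p) * x (p.2, p.1)).re := by
      rw [Complex.star_def, mul_comm]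
    linarith
  have hsum := Finset.sum_le_sum fun p (_ : p ∈ Finset.univ) => hterm p
  rw [← Finset.mul_sum, Finset.sum_neg_distrib, Finset.sum_add_distrib, hswap] at hsum
  simp only [Pi.star_apply] at hsum ⊢
  linarith

/-- **The third-index block of `T2` is dominated by `N + 2γ_kk`** (quadratic-form version): on the
DQG-feasible set, for every `x : ι × ι → ℂ`,
`Re x* T2_{(··k),(··k)} x ≤ (N + 2 γ_kk) ‖x‖²` — by `t2Map_thirdBlock_eq`,
`x* T2_k x = x*Γx + γ_kk(‖x‖² − ⟨x,xᵀ⟩) − Σ_i (x_i − xᵀ_i)* Γ_k (x_i − xᵀ_i)` with `Γ ⪯ N · 1`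
(Garrod–Percus, Chaykin et al. 2016 (4.3)), `Γ_k ⪰ 0`, `0 ≤ γ_kk`. Sharpens the per-block share of the
printed trace constant (4.6). [cite: ChaykinEtAl2016RigorousESC, §4.1 eqs. (4.3), (4.6), p. 15] -/
theorem IsDQGFeasible.re_quadForm_t2Map_thirdBlock_le (h : IsDQGFeasible N γ Γ) (k : ι)
    (x : ι × ι → ℂ) :
    (star x ⬝ᵥ ((t2Map γ Γ).submatrix (fun p : ι × ι => (p.1, p.2, k))
        (fun p : ι × ι => (p.1, p.2, k)) *ᵥ x)).re ≤ ((N : ℝ) + 2 * (γ k k).re) * ∑ p, ‖x p‖ ^ 2 := by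
  classical
  have hΓk_psd : (Γ.submatrix (Prod.mk k) (Prod.mk k)).PosSemidef := h.d_psd.submatrix _
  -- the quadratic forms of the pieces
  have hK1 : star x ⬝ᵥ ((Matrix.of fun p q : ι × ι =>
      (if q.1 = p.1 then (1 : ℂ) else 0) * Γ (k, p.2) (k, q.2)) *ᵥ x) =
      ∑ i, star (fun m => x (i, m)) ⬝ᵥ (Γ.submatrix (Prod.mk k) (Prod.mk k) *ᵥ fun m => x (i, m)) := by
    rw [dotProduct, Fintype.sum_prod_type]
    refine Finset.sum_congr rfl fun i _ => ?_
    rw [dotProduct]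
    refine Finset.sum_congr rfl fun j _ => ?_
    rw [Pi.star_apply, Pi.star_apply, mulVec_kron_fst_fst Γ k]
  have hK2 : star x ⬝ᵥ ((Matrix.of fun p q : ι × ι =>
      (if q.1 = p.2 then (1 : ℂ) else 0) * Γ (k, p.1) (k, q.2)) *ᵥ x) =
      ∑ j, star (fun l => x (l, j)) ⬝ᵥ (Γ.submatrix (Prod.mk k) (Prod.mk k) *ᵥ fun m => x (j, m)) := by
    rw [dotProduct, Fintype.sum_prod_type, Finset.sum_comm]
    refine Finset.sum_congr rfl fun j _ => ?_
    rw [dotProduct]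
    refine Finset.sum_congr rfl fun i _ => ?_
    rw [Pi.star_apply, Pi.star_apply, mulVec_kron_fst_snd Γ k]
  have hK3 : star x ⬝ᵥ ((Matrix.of fun p q : ι × ι =>
      (if q.2 = p.1 then (1 : ℂ) else 0) * Γ (k, p.2) (k, q.1)) *ᵥ x) =
      ∑ i, star (fun m => x (i, m)) ⬝ᵥ (Γ.submatrix (Prod.mk k) (Prod.mk k) *ᵥ fun l => x (l, i)) := by
    rw [dotProduct, Fintype.sum_prod_type]
    refine Finset.sum_congr rfl fun i _ => ?_
    rw [dotProduct]
    refine Finset.sum_congr rfl fun j _ => ?_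
    rw [Pi.star_apply, Pi.star_apply, mulVec_kron_snd_fst Γ k]
  have hK4 : star x ⬝ᵥ ((Matrix.of fun p q : ι × ι =>
      (if q.2 = p.2 then (1 : ℂ) else 0) * Γ (k, p.1) (k, q.1)) *ᵥ x) =
      ∑ j, star (fun l => x (l, j)) ⬝ᵥ (Γ.submatrix (Prod.mk k) (Prod.mk k) *ᵥ fun l => x (l, j)) := by
    rw [dotProduct, Fintype.sum_prod_type, Finset.sum_comm]
    refine Finset.sum_congr rfl fun j _ => ?_
    rw [dotProduct]
    refine Finset.sum_congr rfl fun i _ => ?_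
    rw [Pi.star_apply, Pi.star_apply, mulVec_kron_snd_snd Γ k]
  have hE : star x ⬝ᵥ ((Matrix.of fun p q : ι × ι =>
      (if q.1 = p.1 then (1 : ℂ) else 0) * (if q.2 = p.2 then (1 : ℂ) else 0)) *ᵥ x) = star x ⬝ᵥ x := by
    rw [dotProduct, dotProduct]
    exact Finset.sum_congr rfl fun p _ => by rw [mulVec_delta_id]
  have hP : star x ⬝ᵥ ((Matrix.of fun p q : ι × ι =>
      (if q.1 = p.2 then (1 : ℂ) else 0) * (if q.2 = p.1 then (1 : ℂ) else 0)) *ᵥ x) =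
      star x ⬝ᵥ fun p : ι × ι => x (p.2, p.1) := by
    rw [dotProduct, dotProduct]
    exact Finset.sum_congr rfl fun p _ => by rw [mulVec_delta_swap]
  -- the antisymmetrised rows `y_i = x_i − xᵀ_i` carry the four Kronecker terms
  have hY : ∀ i, star (fun m => x (i, m) - x (m, i)) ⬝ᵥ (Γ.submatrix (Prod.mk k) (Prod.mk k) *ᵥ fun m => x (i, m) - x (m, i)) =
      star (fun m => x (i, m)) ⬝ᵥ (Γ.submatrix (Prod.mk k) (Prod.mk k) *ᵥ fun m => x (i, m))
        - star (fun m => x (i, m)) ⬝ᵥ (Γ.submatrix (Prod.mk k) (Prod.mk k) *ᵥ fun l => x (l, i))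
        - star (fun l => x (l, i)) ⬝ᵥ (Γ.submatrix (Prod.mk k) (Prod.mk k) *ᵥ fun m => x (i, m))
        + star (fun l => x (l, i)) ⬝ᵥ (Γ.submatrix (Prod.mk k) (Prod.mk k) *ᵥ fun l => x (l, i)) := by
    intro i
    have hsplit : (fun m => x (i, m) - x (m, i)) = (fun m => x (i, m)) - fun m => x (m, i) := rfl
    rw [hsplit, star_sub, mulVec_sub, sub_dotProduct, dotProduct_sub, dotProduct_sub]
    ring
  have hYsum : ∑ i, star (fun m => x (i, m) - x (m, i)) ⬝ᵥ (Γ.submatrix (Prod.mk k) (Prod.mk k) *ᵥ fun m => x (i, m) - x (m, i)) =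
      ∑ i, star (fun m => x (i, m)) ⬝ᵥ (Γ.submatrix (Prod.mk k) (Prod.mk k) *ᵥ fun m => x (i, m))
        - ∑ i, star (fun m => x (i, m)) ⬝ᵥ (Γ.submatrix (Prod.mk k) (Prod.mk k) *ᵥ fun l => x (l, i))
        - ∑ j, star (fun l => x (l, j)) ⬝ᵥ (Γ.submatrix (Prod.mk k) (Prod.mk k) *ᵥ fun m => x (j, m))
        + ∑ j, star (fun l => x (l, j)) ⬝ᵥ (Γ.submatrix (Prod.mk k) (Prod.mk k) *ᵥ fun l => x (l, j)) := by
    simp only [hY, Finset.sum_add_distrib, Finset.sum_sub_distrib]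
  -- the block quadratic form
  have hquad : star x ⬝ᵥ ((t2Map γ Γ).submatrix (fun p : ι × ι => (p.1, p.2, k))
      (fun p : ι × ι => (p.1, p.2, k)) *ᵥ x) =
      star x ⬝ᵥ (Γ *ᵥ x) + γ k k * (star x ⬝ᵥ x - star x ⬝ᵥ fun p : ι × ι => x (p.2, p.1))
        - ∑ i, star (fun m => x (i, m) - x (m, i)) ⬝ᵥ (Γ.submatrix (Prod.mk k) (Prod.mk k) *ᵥ fun m => x (i, m) - x (m, i)) := by
    rw [t2Map_thirdBlock_eq, hYsum]
    simp only [add_mulVec, sub_mulVec, smul_mulVec, dotProduct_add, dotProduct_sub, dotProduct_smul,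
      smul_eq_mul, hK1, hK2, hK3, hK4, hE, hP]
    ring
  -- the estimates
  have hN : (N : ℂ) = (((N : ℝ)) : ℂ) := (Complex.ofReal_natCast N).symm
  have hGP : (star x ⬝ᵥ (Γ *ᵥ x)).re ≤ (N : ℝ) * ∑ p, ‖x p‖ ^ 2 := by
    have h1 := h.posSemidef_natCast_smul_one_sub_two
    rw [hN] at h1
    exact re_quadForm_le_of_smul_one_sub h1 x
  have hYnn : 0 ≤ (∑ i, star (fun m => x (i, m) - x (m, i)) ⬝ᵥ
      (Γ.submatrix (Prod.mk k) (Prod.mk k) *ᵥ fun m => x (i, m) - x (m, i))).re := by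
    rw [Complex.re_sum]
    exact Finset.sum_nonneg fun i _ => (Complex.nonneg_iff.mp (hΓk_psd.dotProduct_mulVec_nonneg _)).1
  have hγre := (h.diag_nonneg k).1
  have hγim := (h.diag_nonneg k).2
  have hswap := neg_sum_norm_sq_le_re_dotProduct_swap x
  have hmid : (γ k k * (star x ⬝ᵥ x - star x ⬝ᵥ fun p : ι × ι => x (p.2, p.1))).re ≤
      2 * (γ k k).re * ∑ p, ‖x p‖ ^ 2 := by
    rw [Complex.mul_re, hγim, zero_mul, sub_zero, Complex.sub_re, star_dotProduct_self_eq_ofReal_sum',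
      Complex.ofReal_re]
    nlinarith
  rw [hquad, Complex.sub_re, Complex.add_re]
  nlinarith

/-- **Löwner form of the third-index block bound**: on the `PQGT1T2`-feasible set (so that `T2` is
Hermitian), `(N + 2γ_kk) · 1 − T2_{(··k),(··k)} ⪰ 0` for every annihilator index `k`.
[cite: ChaykinEtAl2016RigorousESC, §4.1 eqs. (4.3), (4.6), p. 15] -/
theorem IsDQGT1T2Feasible.posSemidef_smul_one_sub_t2Map_thirdBlock (h : IsDQGT1T2Feasible N γ Γ) (k : ι) :
    (((((N : ℝ) + 2 * (γ k k).re : ℝ)) : ℂ) • (1 : Matrix (ι × ι) (ι × ι) ℂ) -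
      (t2Map γ Γ).submatrix (fun p : ι × ι => (p.1, p.2, k)) (fun p : ι × ι => (p.1, p.2, k))).PosSemidef := by
  have hT : ((t2Map γ Γ).submatrix (fun p : ι × ι => (p.1, p.2, k))
      (fun p : ι × ι => (p.1, p.2, k))).PosSemidef := h.t2_psd.submatrix _
  have hherm : (((((N : ℝ) + 2 * (γ k k).re : ℝ)) : ℂ) • (1 : Matrix (ι × ι) (ι × ι) ℂ) -
      (t2Map γ Γ).submatrix (fun p : ι × ι => (p.1, p.2, k)) (fun p : ι × ι => (p.1, p.2, k))).IsHermitian := by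
    have h1 : (((((N : ℝ) + 2 * (γ k k).re : ℝ)) : ℂ) • (1 : Matrix (ι × ι) (ι × ι) ℂ)).IsHermitian := by
      rw [IsHermitian, conjTranspose_smul, conjTranspose_one, Complex.star_def, Complex.conj_ofReal]
    exact h1.sub hT.1
  refine PosSemidef.of_dotProduct_mulVec_nonneg hherm fun x => ?_
  have hle := h.toIsDQGFeasible.re_quadForm_t2Map_thirdBlock_le k x
  have him : (star x ⬝ᵥ ((t2Map γ Γ).submatrix (fun p : ι × ι => (p.1, p.2, k))
      (fun p : ι × ι => (p.1, p.2, k)) *ᵥ x)).im = 0 :=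
    (Complex.nonneg_iff.mp (hT.dotProduct_mulVec_nonneg x)).2.symm
  rw [sub_mulVec, smul_mulVec, one_mulVec, dotProduct_sub, dotProduct_smul, smul_eq_mul,
    star_dotProduct_self_eq_ofReal_sum', ← Complex.ofReal_mul, Complex.nonneg_iff, Complex.sub_re,
    Complex.ofReal_re, Complex.sub_im, Complex.ofReal_im, him, sub_zero]
  exact ⟨by linarith, rfl⟩

/-! ### The operator bound for `T2` -/

/-- Re-indexing a Löwner bound along an injective map (plumbing). [folklore] -/
private theorem submatrix_smul_one_sub' {m l : Type*} [DecidableEq m] [DecidableEq l] (c : ℂ)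
    (A : Matrix m m ℂ) {e : l → m} (he : Function.Injective e) :
    (c • (1 : Matrix m m ℂ) - A).submatrix e e = c • (1 : Matrix l l ℂ) - A.submatrix e e := by
  ext i j
  simp only [submatrix_apply, Matrix.sub_apply, Matrix.smul_apply, Matrix.one_apply, he.eq_iff]

/-- **`λ_max(T2) ≤ N(r + 2)` on the `PQGT1T2`-feasible set**, as `N(r+2) · 1 − t2Map γ Γ ⪰ 0`
(`r = |ι|`): the engine `posSemidef_sum_smul_one_sub_of_rowBlocks` over the annihilator index `k` with
the block constants `N + 2γ_kk`, `Σ_k (N + 2γ_kk) = rN + 2N`. SHARPENS the printed trace constant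
`λmax(T2) ≤ Nr(r−N)` of (4.6) by the factor `r(r−N)/(r+2)`; proved here, not printed (the printed form
is `IsDQGT1T2Feasible.trace_smul_one_sub_t2Map_posSemidef`, `T2ConditionTrace.lean`).
[cite: ChaykinEtAl2016RigorousESC, §4.1 eq. (4.6), p. 15] -/
theorem IsDQGT1T2Feasible.posSemidef_smul_one_sub_t2Map (h : IsDQGT1T2Feasible N γ Γ) :
    (((N : ℂ) * (Fintype.card ι + 2)) • (1 : Matrix (ι × ι × ι) (ι × ι × ι) ℂ) - t2Map γ Γ).PosSemidef := by
  classical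
  -- bring the annihilator index to the front: `e (k, (i, j)) = (i, j, k)`
  let e : ι × (ι × ι) ≃ ι × ι × ι := (Equiv.prodComm ι (ι × ι)).trans (Equiv.prodAssoc ι ι ι)
  have he : ∀ k (p : ι × ι), e (k, p) = (p.1, p.2, k) := fun k p => rfl
  have hM : ((t2Map γ Γ).submatrix e e).PosSemidef := h.t2_psd.submatrix _
  have hblock : ∀ k, (((((N : ℝ) + 2 * (γ k k).re : ℝ)) : ℂ) • (1 : Matrix (ι × ι) (ι × ι) ℂ) -
      ((t2Map γ Γ).submatrix e e).submatrix (Prod.mk k) (Prod.mk k)).PosSemidef := by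
    intro k
    have hb : ((t2Map γ Γ).submatrix e e).submatrix (Prod.mk k) (Prod.mk k) =
        (t2Map γ Γ).submatrix (fun p : ι × ι => (p.1, p.2, k)) (fun p : ι × ι => (p.1, p.2, k)) := by
      ext p q
      rfl
    rw [hb]
    exact h.posSemidef_smul_one_sub_t2Map_thirdBlock k
  have hw : ∀ k, 0 ≤ (N : ℝ) + 2 * (γ k k).re := fun k => by
    have := (h.toIsDQGFeasible.diag_nonneg k).1
    positivity
  have heng := posSemidef_sum_smul_one_sub_of_rowBlocks hM hw hblock
  -- the constant: `Σ_k (N + 2 Re γ_kk) = N (r + 2)`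
  have hsum : (((∑ k, ((N : ℝ) + 2 * (γ k k).re) : ℝ)) : ℂ) = (N : ℂ) * (Fintype.card ι + 2) := by
    have htr : ∑ k, (((γ k k).re : ℝ) : ℂ) = (N : ℂ) := by
      rw [← h.toIsDQGFeasible.trace_one]
      refine Finset.sum_congr rfl fun k _ => ?_
      exact (Complex.ext (by simp) (by simp [(h.toIsDQGFeasible.diag_nonneg k).2])).symm
    rw [Finset.sum_add_distrib, Finset.sum_const, Finset.card_univ, nsmul_eq_mul, ← Finset.mul_sum]
    push_cast
    rw [htr]
    ring
  rw [hsum] at heng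
  rw [← Matrix.posSemidef_submatrix_equiv e, submatrix_smul_one_sub' _ _ e.injective]
  exact heng

/-- **The same bound on the `PQGT1T2′`-feasible set** (`T2′ ⇒ T2`, Nakata et al. 2008 §II.B):
`N(r+2) · 1 − t2Map γ Γ ⪰ 0`. [cite: ChaykinEtAl2016RigorousESC, §4.1 eq. (4.6), p. 15] -/
theorem IsDQGT1T2PrimeFeasible.posSemidef_smul_one_sub_t2Map (h : IsDQGT1T2PrimeFeasible N γ Γ) :
    (((N : ℂ) * (Fintype.card ι + 2)) • (1 : Matrix (ι × ι × ι) (ι × ι × ι) ℂ) - t2Map γ Γ).PosSemidef :=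
  h.toIsDQGT1T2Feasible.posSemidef_smul_one_sub_t2Map

end ThirdBlock

end Literature.MathematicalPhysics.QuantumChemistry

end
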